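import Summits.QuantumFields.YangMills.Theorems.UnitScaleTiltProp7PinnedRegaugeChartDivergenceTorus
import HarnessLib

/-!
# Prop 7 pinned re-gauge chart — the junction `Y = e^{iD} − 1 ↔ iD` for the covariant energies (S4′, part 2)

Route-R E′, path (α′), junction S4′ of `stmt-QuantumFields-19200` (crux `MinimiserStabilityRegPr`), cell ym3-torus, width seat px15.

WHY.  The (P-bch-div) rows ✓p660134∕✓p660601 are in the letters of the ratio field `Y` (`Y_b = e^{iD‴_b} − 1`); the knit's door speaks the chart
`D‴`.  Since `e^Z − 1 − Z` is second order and CONJUGATION-EQUIVARIANT, its covariant differences are `(e^s − 1)`-small multiples of those of `Z`: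
`‖D_μ(e^Z − 1) − D_μZ‖ ≤ (e^s − 1)‖D_μZ‖` for `‖Z‖ ≤ s`.  Hence the divergence ∕ curl ∕ mass energies of `Y` are at most twice those of `iD‴` plus
`(e^s − 1)²` times the covariant gradient energy of `iD‴`, which the op-norm Weitzenböck inequality (✓ `Prop7CovIterLambdaHLambdaBridge`) books by
curl + divergence + curvature·mass.

WHAT IS PROVED (def-free).  §1 ★ `norm_exp_sub_sub_exp_sub_le` (`‖(eˣ − x) − (eʸ − y)‖ ≤ ‖x − y‖·(e^{max(‖x‖,‖y‖)} − 1)`, any Banach algebra);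
§2 (any shifts, units background with `SU(N)` values) `norm_R_eq`, `R_exp`, ★ `norm_covD_expm1_sub_le`, ★ `norm_covDstar_expm1_sub_le`;
§3 (torus, `U₀ : GaugeField P i SU(N)`, `dist1(U₀(∂p)) ≤ a`, `‖D_b‖ ≤ s`) `sum_norm_expm1_sq_le` (`Σ‖Y‖² ≤ 4Σ‖D‖²`, `s ≤ 1`),
`sum_full_covD_sq_le_curl_divB`, ★★★ `divHS_expm1_le` (`DIV_HS(Y) ≤ 2N·DIV_HS(iD) + 2Nd(e^s − 1)²·[CURL_HS(iD) + DIV_HS(iD) + 2daN·Σ‖iD‖²]`),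
★★★ `curlHS_expm1_le` (`CURL_HS(Y) ≤ 2N·CURL_HS(iD) + 8N(e^s − 1)²·[same bracket]`).  With ✓ `Prop7PlaquetteCurlComparison.curlHS_le_plaqK` every
`CURL_HS(iD)` further converts to the door's `K_W(iD)`.  HONEST SCOPE: junction bookkeeping; constants ours; nothing of the cited papers is asserted.

References: T. Bałaban, CMP 102 (1985) 277–309 [Balaban1985Variational] ((135) p.298, (141)–(143) p.299); CMP 99 (1985) 389–434
[Balaban1985BackgroundPropagators] ((3.3)–(3.10) pp.390–392).
-/

set_option autoImplicit false
noncomputable section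

open scoped BigOperators Matrix.Norms.L2Operator Matrix
open NormedSpace Nat

namespace Summit.QuantumFields.YangMills.Theorems.Prop7PinnedRegaugeChartJunction

open Literature.MathematicalPhysics.QuantumFieldTheory.Balaban1983to89
open Finset B1RG242Torus
open Literature.Analysis.Complex (norm_pow_succ_sub_pow_succ_le)
open B7Eq78Linearization (conjR)
open B9Eq39Adjoint (R R_def R_add R_sub R_inv_R R_apply_one covD covDstar curl divB)
open B10StarCount (sum_pbond)
open B10Eq27TorusAxialLog (unitsField toUField)
open B9TorusCalculus (torusT)
open Summit.QuantumFields.YangMills.Theorems.Prop7HolRatioPerStep (coe_star_mul_self coe_mul_star_self)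
open Summit.QuantumFields.YangMills.Theorems.Prop7CovIterLambdaBound (norm_conj_su_le)
open Summit.QuantumFields.YangMills.Theorems.Prop7CovariantCoercivity (sum_norm_sq_le_mul_opNorm_sq)
open Summit.QuantumFields.YangMills.Theorems.Prop7CovCombMeanFrames (conjR_bond_su)
open Summit.QuantumFields.YangMills.Theorems.Prop7CovIterLambdaHLambdaBridge (sum_normSq_covGrad_le_curl_divB)
open Summit.QuantumFields.YangMills.Theorems.Prop7PinnedRegaugeChartDivergence (coe_inv_eq_star R_inv_eq_star_mul sq_sum_univ_le_card_mul)
open Summit.QuantumFields.YangMills.Theorems.Prop7PinnedRegaugeChartDivergenceTorus (norm_R_inv_eq coe_unitsField_toUField sum_norm_covDstar_sq_eq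
  sum_diag_covD_sq_le_curl_divB)

/-! ## §1 `exp` is second-order Lipschitz -/

section ExpC1

variable {𝔄 : Type*} [NormedRing 𝔄] [NormedAlgebra ℂ 𝔄] [CompleteSpace 𝔄] [NormOneClass 𝔄]

/-- **`exp` is second-order Lipschitz**: `‖(eˣ − x) − (eʸ − y)‖ ≤ ‖x − y‖·(e^{max(‖x‖,‖y‖)} − 1)` in any Banach algebra
(term-wise from `‖xⁿ − yⁿ‖ ≤ nMⁿ⁻¹‖x − y‖`, `n ≥ 2`; companion of ✓ `Literature.Analysis.Complex.norm_exp_sub_exp_le`). [folklore] -/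
theorem norm_exp_sub_sub_exp_sub_le (x y : 𝔄) :
    ‖(exp x - x) - (exp y - y)‖ ≤ ‖x - y‖ * (Real.exp (max ‖x‖ ‖y‖) - 1) := by
  nontriviality 𝔄
  set M := max ‖x‖ ‖y‖ with hM
  have hsub := (exp_series_hasSum_exp' (𝕂 := ℂ) x).sub (exp_series_hasSum_exp' (𝕂 := ℂ) y)
  have h2 := (hasSum_nat_add_iff' 2).mpr hsub
  have hinit : ∑ i ∈ Finset.range 2, (((i ! : ℂ))⁻¹ • x ^ i - ((i ! : ℂ))⁻¹ • y ^ i) = x - y := by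
    simp [Finset.sum_range_succ]
  rw [hinit] at h2
  have e : (exp x - x) - (exp y - y) = (exp x - exp y) - (x - y) := by abel
  rw [e, ← h2.tsum_eq]
  -- dominating real series `M^{n+1}/(n+1)! · ‖x − y‖`, sum `(e^M − 1)‖x − y‖`
  have hreal : HasSum (fun n : ℕ => M ^ n / n !) (Real.exp M) := by
    have h := exp_series_hasSum_exp' (𝕂 := ℝ) M
    rw [← Real.exp_eq_exp_ℝ] at h
    simpa [smul_eq_mul, div_eq_inv_mul] using h
  have h1 := (hasSum_nat_add_iff' 1).mpr hreal
  have hinit' : ∑ i ∈ Finset.range 1, M ^ i / (i ! : ℝ) = 1 := by simp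
  rw [hinit'] at h1
  have hb : HasSum (fun n : ℕ => M ^ (n + 1) / ((n + 1) ! : ℝ) * ‖x - y‖) ((Real.exp M - 1) * ‖x - y‖) := h1.mul_right _
  rw [mul_comm]
  refine tsum_of_norm_bounded hb fun n => ?_
  rw [← smul_sub, norm_smul, norm_inv, Complex.norm_natCast]
  have hfac : ((n + 2) ! : ℝ) = (n + 2) * (n + 1) ! := by push_cast [Nat.factorial_succ]; ring
  have hm0 : (0 : ℝ) < (n + 1) ! := by positivity
  have hp := norm_pow_succ_sub_pow_succ_le x y (n + 1)
  rw [← hM] at hp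
  calc ((n + 2) ! : ℝ)⁻¹ * ‖x ^ (n + 2) - y ^ (n + 2)‖
      ≤ ((n + 2) ! : ℝ)⁻¹ * ((↑(n + 1) + 1) * M ^ (n + 1) * ‖x - y‖) :=
        mul_le_mul_of_nonneg_left hp (by positivity)
    _ = M ^ (n + 1) / ((n + 1) ! : ℝ) * ‖x - y‖ := by
        rw [hfac]; push_cast; field_simp; ring

end ExpC1

/-! ## §2 Covariant differences of `e^Z − 1` against those of `Z` -/

section Lattice

variable {n : Type*} [Fintype n] [DecidableEq n] [Nonempty n]
variable {S : Type*} {ι : Type*} (T : ι → Equiv.Perm S) (U : ι → S → (Matrix n n ℂ)ˣ)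
  (W : ι → S → Matrix.specialUnitaryGroup n ℂ)

/-- Transport by an `SU(N)` value is an isometry: `‖R(U_μ(y))Z‖ = ‖Z‖`. [folklore] -/
theorem norm_R_eq (hUW : ∀ μ x, (U μ x : Matrix n n ℂ) = (W μ x : Matrix n n ℂ)) (μ : ι) (y : S) (Z : Matrix n n ℂ) :
    ‖R (U μ y) Z‖ = ‖Z‖ := by
  rw [R_def, coe_inv_eq_star U W hUW, hUW]
  apply le_antisymm
  · exact norm_conj_su_le (W μ y) Z
  · have h := norm_conj_su_le (star (W μ y)) ((W μ y : Matrix n n ℂ) * Z * star (W μ y : Matrix n n ℂ))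
    have hc : ((star (W μ y) : Matrix.specialUnitaryGroup n ℂ) : Matrix n n ℂ) = star (W μ y : Matrix n n ℂ) := rfl
    rw [hc, star_star] at h
    have e : star (W μ y : Matrix n n ℂ) * ((W μ y : Matrix n n ℂ) * Z * star (W μ y : Matrix n n ℂ)) * (W μ y : Matrix n n ℂ)
        = (star (W μ y : Matrix n n ℂ) * (W μ y : Matrix n n ℂ)) * Z * (star (W μ y : Matrix n n ℂ) * (W μ y : Matrix n n ℂ)) := by
      noncomm_ring
    rw [e, coe_star_mul_self, one_mul, mul_one] at h
    exact h

omit [Nonempty n] in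
/-- `exp` commutes with transport: `R(g)(e^A) = e^{R(g)A}` for every unit `g`. [folklore] -/
theorem R_exp (g : (Matrix n n ℂ)ˣ) (A : Matrix n n ℂ) : R g (exp A) = exp (R g A) := by
  rw [R_def, R_def]; exact (Matrix.exp_units_conj g A).symm

/-- ★ **Covariant differences of `e^Z − 1` against those of `Z`** (forward bond): for `‖Z(z)‖ ≤ s` everywhere,
`‖D_μ(e^Z − 1)(x) − D_μZ(x)‖ ≤ (e^s − 1)·‖D_μZ(x)‖` (`exp` commutes with transport; second-order Lipschitz of `exp`; transport is an isometry).
[cite: Balaban1985BackgroundPropagators, (3.3) p.390] -/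
theorem norm_covD_expm1_sub_le (hUW : ∀ μ x, (U μ x : Matrix n n ℂ) = (W μ x : Matrix n n ℂ)) (Z : S → Matrix n n ℂ) {s : ℝ}
    (hZ : ∀ z, ‖Z z‖ ≤ s) (μ : ι) (x : S) :
    ‖covD T U μ (fun z => exp (Z z) - 1) x - covD T U μ Z x‖ ≤ (Real.exp s - 1) * ‖covD T U μ Z x‖ := by
  have e : covD T U μ (fun z => exp (Z z) - 1) x - covD T U μ Z x
      = (exp (R (U μ x) (Z (T μ x))) - R (U μ x) (Z (T μ x))) - (exp (Z x) - Z x) := by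
    simp only [covD, R_sub, R_exp, R_apply_one]
    abel
  rw [e]
  have h := norm_exp_sub_sub_exp_sub_le (R (U μ x) (Z (T μ x))) (Z x)
  have hmax : max ‖R (U μ x) (Z (T μ x))‖ ‖Z x‖ ≤ s := by
    rw [norm_R_eq U W hUW]; exact max_le (hZ _) (hZ _)
  have hexp : Real.exp (max ‖R (U μ x) (Z (T μ x))‖ ‖Z x‖) - 1 ≤ Real.exp s - 1 := by
    linarith [Real.exp_le_exp.mpr hmax]
  have h0 : 0 ≤ ‖R (U μ x) (Z (T μ x)) - Z x‖ := norm_nonneg _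
  calc ‖(exp (R (U μ x) (Z (T μ x))) - R (U μ x) (Z (T μ x))) - (exp (Z x) - Z x)‖
      ≤ ‖R (U μ x) (Z (T μ x)) - Z x‖ * (Real.exp s - 1) := h.trans (mul_le_mul_of_nonneg_left hexp h0)
    _ = (Real.exp s - 1) * ‖covD T U μ Z x‖ := by rw [mul_comm]; rfl

/-- ★ The same along the reversed bond: `‖D*_μ(e^Z − 1)(x) − D*_μZ(x)‖ ≤ (e^s − 1)·‖D*_μZ(x)‖`.
[cite: Balaban1985BackgroundPropagators, (3.8) p.392] -/
theorem norm_covDstar_expm1_sub_le (hUW : ∀ μ x, (U μ x : Matrix n n ℂ) = (W μ x : Matrix n n ℂ)) (Z : S → Matrix n n ℂ) {s : ℝ}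
    (hZ : ∀ z, ‖Z z‖ ≤ s) (μ : ι) (x : S) :
    ‖covDstar T U μ (fun z => exp (Z z) - 1) x - covDstar T U μ Z x‖ ≤ (Real.exp s - 1) * ‖covDstar T U μ Z x‖ := by
  have e : covDstar T U μ (fun z => exp (Z z) - 1) x - covDstar T U μ Z x
      = (exp (R (U μ ((T μ).symm x))⁻¹ (Z ((T μ).symm x))) - R (U μ ((T μ).symm x))⁻¹ (Z ((T μ).symm x))) - (exp (Z x) - Z x) := by
    simp only [covDstar, R_sub, R_exp, R_apply_one]
    abel
  rw [e]
  have h := norm_exp_sub_sub_exp_sub_le (R (U μ ((T μ).symm x))⁻¹ (Z ((T μ).symm x))) (Z x)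
  have hn : ‖R (U μ ((T μ).symm x))⁻¹ (Z ((T μ).symm x))‖ = ‖Z ((T μ).symm x)‖ := norm_R_inv_eq U W hUW μ _ _
  have hmax : max ‖R (U μ ((T μ).symm x))⁻¹ (Z ((T μ).symm x))‖ ‖Z x‖ ≤ s := by
    rw [hn]; exact max_le (hZ _) (hZ _)
  have hexp : Real.exp (max ‖R (U μ ((T μ).symm x))⁻¹ (Z ((T μ).symm x))‖ ‖Z x‖) - 1 ≤ Real.exp s - 1 := by
    linarith [Real.exp_le_exp.mpr hmax]
  have h0 : 0 ≤ ‖R (U μ ((T μ).symm x))⁻¹ (Z ((T μ).symm x)) - Z x‖ := norm_nonneg _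
  calc ‖(exp (R (U μ ((T μ).symm x))⁻¹ (Z ((T μ).symm x))) - R (U μ ((T μ).symm x))⁻¹ (Z ((T μ).symm x))) - (exp (Z x) - Z x)‖
      ≤ ‖R (U μ ((T μ).symm x))⁻¹ (Z ((T μ).symm x)) - Z x‖ * (Real.exp s - 1) := h.trans (mul_le_mul_of_nonneg_left hexp h0)
    _ = (Real.exp s - 1) * ‖covDstar T U μ Z x‖ := by rw [mul_comm]; rfl

end Lattice

/-! ## §3 On the torus: the energies of `Y = e^{iD} − 1` against those of `iD` -/

section Torus

variable {P : Params} {N : ℕ} [NeZero N] {i : ℕ}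

omit [NeZero N] in
/-- **Mass**: for `‖D_b‖ ≤ s ≤ 1`, `Σ_b‖e^{iD_b} − 1‖² ≤ 4·Σ_b‖D_b‖²` (`|e^t − 1| ≤ 2t` on `[0,1]`). [folklore] -/
theorem sum_norm_expm1_sq_le (D : PBond P i → Matrix (Fin N) (Fin N) ℂ) {s : ℝ} (hs : s ≤ 1) (hD : ∀ b, ‖D b‖ ≤ s) :
    ∑ b : PBond P i, ‖exp (Complex.I • D b) - 1‖ ^ 2 ≤ 4 * ∑ b : PBond P i, ‖D b‖ ^ 2 := by
  rw [Finset.mul_sum]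
  refine Finset.sum_le_sum fun b _ => ?_
  have hI : ‖Complex.I • D b‖ = ‖D b‖ := by rw [norm_smul, Complex.norm_I, one_mul]
  have h1 := Literature.Analysis.Calculus.norm_exp_sub_one_le (Complex.I • D b)
  rw [hI] at h1
  have h2 : Real.exp ‖D b‖ - 1 ≤ 2 * ‖D b‖ := by
    have h := Real.abs_exp_sub_one_le (x := ‖D b‖) (by rw [abs_of_nonneg (norm_nonneg _)]; exact (hD b).trans hs)
    rw [abs_of_nonneg (norm_nonneg _)] at h
    exact (le_abs_self _).trans h
  have h0 : 0 ≤ ‖exp (Complex.I • D b) - 1‖ := norm_nonneg _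
  nlinarith [h1.trans h2]

/-- The FULL covariant gradient energy (covD letters) through curl, divergence and curvature — ✓ `sum_normSq_covGrad_le_curl_divB` re-lettered.
[cite: Balaban1985Variational, (135) p.298] -/
theorem sum_full_covD_sq_le_curl_divB (U₀ : GaugeField P i (Matrix.specialUnitaryGroup (Fin N) ℂ)) {a : ℝ} (ha : 0 ≤ a)
    (hU : ∀ p : Plaq P i, dist1 (GaugeField.plaqHol U₀ p) ≤ a) (G : PBond P i → Matrix (Fin N) (Fin N) ℂ) :
    ∑ x : Site P i, ∑ μ : Fin P.d, ∑ ν : Fin P.d, ‖covD (torusT P i) (fun κ z => unitsField (toUField U₀) ⟨z, κ⟩) ν (fun z => G ⟨z, μ⟩) x‖ ^ 2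
      ≤ (∑ x : Site P i, ∑ μ : Fin P.d, ∑ ν : Fin P.d,
            (if μ < ν then ∑ j : Fin N, ∑ k : Fin N,
              ‖(curl (torusT P i) (fun κ z => unitsField (toUField U₀) ⟨z, κ⟩) (fun κ z => G ⟨z, κ⟩) μ ν x) j k‖ ^ 2 else 0)
          + ∑ x : Site P i, ∑ j : Fin N, ∑ k : Fin N,
              ‖(divB (torusT P i) (fun κ z => unitsField (toUField U₀) ⟨z, κ⟩) (fun κ z => G ⟨z, κ⟩) x) j k‖ ^ 2)
        + 2 * P.d * a * (N * ∑ b : PBond P i, ‖G b‖ ^ 2) := by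
  have hW := sum_normSq_covGrad_le_curl_divB U₀ ha hU G
  refine le_trans (le_of_eq ?_) hW
  rw [sum_pbond]
  refine Finset.sum_congr rfl fun x _ => Finset.sum_congr rfl fun μ _ => Finset.sum_congr rfl fun ν _ => ?_
  rw [← conjR_bond_su]
  rfl

/-- ★★★ **DIVERGENCE ENERGY OF `Y = e^{iD} − 1` AGAINST THAT OF `iD`**: `T^{(i)}`, `SU(N)` background with `dist1(U₀(∂p)) ≤ a`, `‖D_b‖ ≤ s`:
`DIV_HS(Y) ≤ 2N·DIV_HS(iD) + 2N·d·(e^s − 1)²·[CURL_HS(iD) + DIV_HS(iD) + 2daN·Σ_b‖iD_b‖²]`.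
[cite: Balaban1985Variational, (135) p.298] [cite: Balaban1985BackgroundPropagators, (3.8) p.392] -/
theorem divHS_expm1_le (U₀ : GaugeField P i (Matrix.specialUnitaryGroup (Fin N) ℂ)) {a : ℝ} (ha : 0 ≤ a)
    (hU : ∀ p : Plaq P i, dist1 (GaugeField.plaqHol U₀ p) ≤ a) (D : PBond P i → Matrix (Fin N) (Fin N) ℂ) {s : ℝ} (hD : ∀ b, ‖D b‖ ≤ s) :
    (∑ x : Site P i, ∑ j : Fin N, ∑ k : Fin N,
        ‖(divB (torusT P i) (fun κ z => unitsField (toUField U₀) ⟨z, κ⟩) (fun κ z => exp (Complex.I • D ⟨z, κ⟩) - 1) x) j k‖ ^ 2)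
      ≤ 2 * N * (∑ x : Site P i, ∑ j : Fin N, ∑ k : Fin N,
            ‖(divB (torusT P i) (fun κ z => unitsField (toUField U₀) ⟨z, κ⟩) (fun κ z => Complex.I • D ⟨z, κ⟩) x) j k‖ ^ 2)
        + 2 * N * P.d * (Real.exp s - 1) ^ 2 *
          ((∑ x : Site P i, ∑ μ : Fin P.d, ∑ ν : Fin P.d,
              (if μ < ν then ∑ j : Fin N, ∑ k : Fin N,
                ‖(curl (torusT P i) (fun κ z => unitsField (toUField U₀) ⟨z, κ⟩) (fun κ z => Complex.I • D ⟨z, κ⟩) μ ν x) j k‖ ^ 2 else 0)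
            + ∑ x : Site P i, ∑ j : Fin N, ∑ k : Fin N,
                ‖(divB (torusT P i) (fun κ z => unitsField (toUField U₀) ⟨z, κ⟩) (fun κ z => Complex.I • D ⟨z, κ⟩) x) j k‖ ^ 2)
            + 2 * P.d * a * (N * ∑ b : PBond P i, ‖Complex.I • D b‖ ^ 2)) := by
  have hUW := coe_unitsField_toUField U₀
  have hZ : ∀ (μ : Fin P.d) (z : Site P i), ‖Complex.I • D ⟨z, μ⟩‖ ≤ s := fun μ z => by
    rw [norm_smul, Complex.norm_I, one_mul]; exact hD _
  -- pointwise at each site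
  have hpt : ∀ x : Site P i,
      ‖divB (torusT P i) (fun κ z => unitsField (toUField U₀) ⟨z, κ⟩) (fun κ z => exp (Complex.I • D ⟨z, κ⟩) - 1) x‖
        ≤ ‖divB (torusT P i) (fun κ z => unitsField (toUField U₀) ⟨z, κ⟩) (fun κ z => Complex.I • D ⟨z, κ⟩) x‖
          + (Real.exp s - 1) * ∑ μ : Fin P.d, ‖covDstar (torusT P i) (fun κ z => unitsField (toUField U₀) ⟨z, κ⟩) μ (fun z => Complex.I • D ⟨z, μ⟩) x‖ := by
    intro x
    have hdiff : divB (torusT P i) (fun κ z => unitsField (toUField U₀) ⟨z, κ⟩) (fun κ z => exp (Complex.I • D ⟨z, κ⟩) - 1) x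
          - divB (torusT P i) (fun κ z => unitsField (toUField U₀) ⟨z, κ⟩) (fun κ z => Complex.I • D ⟨z, κ⟩) x
        = ∑ μ : Fin P.d, (covDstar (torusT P i) (fun κ z => unitsField (toUField U₀) ⟨z, κ⟩) μ (fun z => exp (Complex.I • D ⟨z, μ⟩) - 1) x
            - covDstar (torusT P i) (fun κ z => unitsField (toUField U₀) ⟨z, κ⟩) μ (fun z => Complex.I • D ⟨z, μ⟩) x) := by
      simp only [divB, ← Finset.sum_sub_distrib]
    have hn : ‖divB (torusT P i) (fun κ z => unitsField (toUField U₀) ⟨z, κ⟩) (fun κ z => exp (Complex.I • D ⟨z, κ⟩) - 1) x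
          - divB (torusT P i) (fun κ z => unitsField (toUField U₀) ⟨z, κ⟩) (fun κ z => Complex.I • D ⟨z, κ⟩) x‖
        ≤ (Real.exp s - 1) * ∑ μ : Fin P.d, ‖covDstar (torusT P i) (fun κ z => unitsField (toUField U₀) ⟨z, κ⟩) μ (fun z => Complex.I • D ⟨z, μ⟩) x‖ := by
      rw [hdiff, Finset.mul_sum]
      refine (norm_sum_le _ _).trans (Finset.sum_le_sum fun μ _ => ?_)
      exact norm_covDstar_expm1_sub_le (torusT P i) _ (fun κ z => U₀ ⟨z, κ⟩) hUW (fun z => Complex.I • D ⟨z, μ⟩) (hZ μ) μ x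
    have key := norm_le_insert'
      (divB (torusT P i) (fun κ z => unitsField (toUField U₀) ⟨z, κ⟩) (fun κ z => exp (Complex.I • D ⟨z, κ⟩) - 1) x)
      (divB (torusT P i) (fun κ z => unitsField (toUField U₀) ⟨z, κ⟩) (fun κ z => Complex.I • D ⟨z, κ⟩) x)
    linarith
  -- square, HS ≤ N·op, op ≤ HS, Cauchy–Schwarz over `μ`
  have hsq : ∀ x : Site P i,
      (∑ j : Fin N, ∑ k : Fin N,
        ‖(divB (torusT P i) (fun κ z => unitsField (toUField U₀) ⟨z, κ⟩) (fun κ z => exp (Complex.I • D ⟨z, κ⟩) - 1) x) j k‖ ^ 2)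
        ≤ 2 * N * (∑ j : Fin N, ∑ k : Fin N,
            ‖(divB (torusT P i) (fun κ z => unitsField (toUField U₀) ⟨z, κ⟩) (fun κ z => Complex.I • D ⟨z, κ⟩) x) j k‖ ^ 2)
          + 2 * N * P.d * (Real.exp s - 1) ^ 2
            * ∑ μ : Fin P.d, ‖covDstar (torusT P i) (fun κ z => unitsField (toUField U₀) ⟨z, κ⟩) μ (fun z => Complex.I • D ⟨z, μ⟩) x‖ ^ 2 := by
    intro x
    have h1 := sum_norm_sq_le_mul_opNorm_sq
      (divB (torusT P i) (fun κ z => unitsField (toUField U₀) ⟨z, κ⟩) (fun κ z => exp (Complex.I • D ⟨z, κ⟩) - 1) x)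
    have h2 := MatrixNorms.opNorm_sq_le_sum_norm_sq
      (divB (torusT P i) (fun κ z => unitsField (toUField U₀) ⟨z, κ⟩) (fun κ z => Complex.I • D ⟨z, κ⟩) x)
    have h3 := sq_sum_univ_le_card_mul (ι := Fin P.d)
      (fun μ => ‖covDstar (torusT P i) (fun κ z => unitsField (toUField U₀) ⟨z, κ⟩) μ (fun z => Complex.I • D ⟨z, μ⟩) x‖)
    rw [Fintype.card_fin] at h3
    have h0 : 0 ≤ ‖divB (torusT P i) (fun κ z => unitsField (toUField U₀) ⟨z, κ⟩) (fun κ z => exp (Complex.I • D ⟨z, κ⟩) - 1) x‖ := norm_nonneg _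
    have h4 := pow_le_pow_left₀ h0 (hpt x) 2
    have hN : (0 : ℝ) ≤ N := Nat.cast_nonneg N
    have hS : 0 ≤ ∑ μ : Fin P.d, ‖covDstar (torusT P i) (fun κ z => unitsField (toUField U₀) ⟨z, κ⟩) μ (fun z => Complex.I • D ⟨z, μ⟩) x‖ :=
      Finset.sum_nonneg fun μ _ => norm_nonneg _
    have hab : ∀ (p q : ℝ), (p + q) ^ 2 ≤ 2 * p ^ 2 + 2 * q ^ 2 := fun p q => by nlinarith [sq_nonneg (p - q)]
    have h5 := hab ‖divB (torusT P i) (fun κ z => unitsField (toUField U₀) ⟨z, κ⟩) (fun κ z => Complex.I • D ⟨z, κ⟩) x‖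
      ((Real.exp s - 1) * ∑ μ : Fin P.d, ‖covDstar (torusT P i) (fun κ z => unitsField (toUField U₀) ⟨z, κ⟩) μ (fun z => Complex.I • D ⟨z, μ⟩) x‖)
    have he : 0 ≤ (Real.exp s - 1) ^ 2 := sq_nonneg _
    nlinarith [mul_le_mul_of_nonneg_left h3 he, mul_le_mul_of_nonneg_left (h4.trans h5) hN]
  -- sum over sites
  have hsum := Finset.sum_le_sum fun x (_ : x ∈ (Finset.univ : Finset (Site P i))) => hsq x
  refine hsum.trans ?_
  rw [Finset.sum_add_distrib, ← Finset.mul_sum, ← Finset.mul_sum]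
  -- the diagonal gradient energy through Weitzenböck
  have hdiag : ∑ x : Site P i, ∑ μ : Fin P.d, ‖covDstar (torusT P i) (fun κ z => unitsField (toUField U₀) ⟨z, κ⟩) μ
        (fun z => Complex.I • D ⟨z, μ⟩) x‖ ^ 2
      ≤ (∑ x : Site P i, ∑ μ : Fin P.d, ∑ ν : Fin P.d,
              (if μ < ν then ∑ j : Fin N, ∑ k : Fin N,
                ‖(curl (torusT P i) (fun κ z => unitsField (toUField U₀) ⟨z, κ⟩) (fun κ z => Complex.I • D ⟨z, κ⟩) μ ν x) j k‖ ^ 2 else 0)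
            + ∑ x : Site P i, ∑ j : Fin N, ∑ k : Fin N,
                ‖(divB (torusT P i) (fun κ z => unitsField (toUField U₀) ⟨z, κ⟩) (fun κ z => Complex.I • D ⟨z, κ⟩) x) j k‖ ^ 2)
            + 2 * P.d * a * (N * ∑ b : PBond P i, ‖Complex.I • D b‖ ^ 2) := by
    refine le_trans (le_of_eq ?_) (sum_diag_covD_sq_le_curl_divB U₀ ha hU (fun b => Complex.I • D b))
    calc ∑ x : Site P i, ∑ μ : Fin P.d, ‖covDstar (torusT P i) (fun κ z => unitsField (toUField U₀) ⟨z, κ⟩) μ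
            (fun z => Complex.I • D ⟨z, μ⟩) x‖ ^ 2
        = ∑ μ : Fin P.d, ∑ x : Site P i, ‖covDstar (torusT P i) (fun κ z => unitsField (toUField U₀) ⟨z, κ⟩) μ
            (fun z => Complex.I • D ⟨z, μ⟩) x‖ ^ 2 := Finset.sum_comm
      _ = ∑ μ : Fin P.d, ∑ x : Site P i, ‖covD (torusT P i) (fun κ z => unitsField (toUField U₀) ⟨z, κ⟩) μ
            (fun z => Complex.I • D ⟨z, μ⟩) x‖ ^ 2 :=
          Finset.sum_congr rfl fun μ _ => sum_norm_covDstar_sq_eq (torusT P i) _ (fun κ z => U₀ ⟨z, κ⟩) hUW μ _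
      _ = ∑ x : Site P i, ∑ μ : Fin P.d, ‖covD (torusT P i) (fun κ z => unitsField (toUField U₀) ⟨z, κ⟩) μ
            (fun z => Complex.I • D ⟨z, μ⟩) x‖ ^ 2 := Finset.sum_comm
  have hc : (0 : ℝ) ≤ 2 * N * P.d * (Real.exp s - 1) ^ 2 := by positivity
  linarith [mul_le_mul_of_nonneg_left hdiag hc]

/-- ★★★ **CURL ENERGY OF `Y = e^{iD} − 1` AGAINST THAT OF `iD`**: same setting,
`CURL_HS(Y) ≤ 2N·CURL_HS(iD) + 8N·(e^s − 1)²·[CURL_HS(iD) + DIV_HS(iD) + 2daN·Σ_b‖iD_b‖²]`.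
[cite: Balaban1985Variational, (135) p.298] [cite: Balaban1985BackgroundPropagators, (3.4) p.391] -/
theorem curlHS_expm1_le (U₀ : GaugeField P i (Matrix.specialUnitaryGroup (Fin N) ℂ)) {a : ℝ} (ha : 0 ≤ a)
    (hU : ∀ p : Plaq P i, dist1 (GaugeField.plaqHol U₀ p) ≤ a) (D : PBond P i → Matrix (Fin N) (Fin N) ℂ) {s : ℝ} (hD : ∀ b, ‖D b‖ ≤ s) :
    (∑ x : Site P i, ∑ μ : Fin P.d, ∑ ν : Fin P.d,
        (if μ < ν then ∑ j : Fin N, ∑ k : Fin N,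
          ‖(curl (torusT P i) (fun κ z => unitsField (toUField U₀) ⟨z, κ⟩) (fun κ z => exp (Complex.I • D ⟨z, κ⟩) - 1) μ ν x) j k‖ ^ 2 else 0))
      ≤ 2 * N * (∑ x : Site P i, ∑ μ : Fin P.d, ∑ ν : Fin P.d,
            (if μ < ν then ∑ j : Fin N, ∑ k : Fin N,
              ‖(curl (torusT P i) (fun κ z => unitsField (toUField U₀) ⟨z, κ⟩) (fun κ z => Complex.I • D ⟨z, κ⟩) μ ν x) j k‖ ^ 2 else 0))
        + 8 * N * (Real.exp s - 1) ^ 2 *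
          ((∑ x : Site P i, ∑ μ : Fin P.d, ∑ ν : Fin P.d,
              (if μ < ν then ∑ j : Fin N, ∑ k : Fin N,
                ‖(curl (torusT P i) (fun κ z => unitsField (toUField U₀) ⟨z, κ⟩) (fun κ z => Complex.I • D ⟨z, κ⟩) μ ν x) j k‖ ^ 2 else 0)
            + ∑ x : Site P i, ∑ j : Fin N, ∑ k : Fin N,
                ‖(divB (torusT P i) (fun κ z => unitsField (toUField U₀) ⟨z, κ⟩) (fun κ z => Complex.I • D ⟨z, κ⟩) x) j k‖ ^ 2)
            + 2 * P.d * a * (N * ∑ b : PBond P i, ‖Complex.I • D b‖ ^ 2)) := by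
  have hUW := coe_unitsField_toUField U₀
  have hZ : ∀ (μ : Fin P.d) (z : Site P i), ‖Complex.I • D ⟨z, μ⟩‖ ≤ s := fun μ z => by
    rw [norm_smul, Complex.norm_I, one_mul]; exact hD _
  have hN : (0 : ℝ) ≤ N := Nat.cast_nonneg N
  have he : 0 ≤ (Real.exp s - 1) ^ 2 := sq_nonneg _
  -- pointwise: `‖curl Y‖ ≤ ‖curl Z‖ + (e^s−1)(‖D_μZ_ν‖ + ‖D_νZ_μ‖)`
  have hpt : ∀ (x : Site P i) (μ ν : Fin P.d),
      (∑ j : Fin N, ∑ k : Fin N,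
          ‖(curl (torusT P i) (fun κ z => unitsField (toUField U₀) ⟨z, κ⟩) (fun κ z => exp (Complex.I • D ⟨z, κ⟩) - 1) μ ν x) j k‖ ^ 2)
        ≤ 2 * N * ‖curl (torusT P i) (fun κ z => unitsField (toUField U₀) ⟨z, κ⟩) (fun κ z => Complex.I • D ⟨z, κ⟩) μ ν x‖ ^ 2
          + 4 * N * (Real.exp s - 1) ^ 2 *
            (‖covD (torusT P i) (fun κ z => unitsField (toUField U₀) ⟨z, κ⟩) μ (fun z => Complex.I • D ⟨z, ν⟩) x‖ ^ 2
              + ‖covD (torusT P i) (fun κ z => unitsField (toUField U₀) ⟨z, κ⟩) ν (fun z => Complex.I • D ⟨z, μ⟩) x‖ ^ 2) := by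
    intro x μ ν
    have hdiff : curl (torusT P i) (fun κ z => unitsField (toUField U₀) ⟨z, κ⟩) (fun κ z => exp (Complex.I • D ⟨z, κ⟩) - 1) μ ν x
          - curl (torusT P i) (fun κ z => unitsField (toUField U₀) ⟨z, κ⟩) (fun κ z => Complex.I • D ⟨z, κ⟩) μ ν x
        = (covD (torusT P i) (fun κ z => unitsField (toUField U₀) ⟨z, κ⟩) μ (fun z => exp (Complex.I • D ⟨z, ν⟩) - 1) x
            - covD (torusT P i) (fun κ z => unitsField (toUField U₀) ⟨z, κ⟩) μ (fun z => Complex.I • D ⟨z, ν⟩) x)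
          - (covD (torusT P i) (fun κ z => unitsField (toUField U₀) ⟨z, κ⟩) ν (fun z => exp (Complex.I • D ⟨z, μ⟩) - 1) x
            - covD (torusT P i) (fun κ z => unitsField (toUField U₀) ⟨z, κ⟩) ν (fun z => Complex.I • D ⟨z, μ⟩) x) := by
      simp only [curl]
      abel
    have hA := norm_covD_expm1_sub_le (torusT P i) _ (fun κ z => U₀ ⟨z, κ⟩) hUW (fun z => Complex.I • D ⟨z, ν⟩) (hZ ν) μ x
    have hB := norm_covD_expm1_sub_le (torusT P i) _ (fun κ z => U₀ ⟨z, κ⟩) hUW (fun z => Complex.I • D ⟨z, μ⟩) (hZ μ) ν x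
    have hn : ‖curl (torusT P i) (fun κ z => unitsField (toUField U₀) ⟨z, κ⟩) (fun κ z => exp (Complex.I • D ⟨z, κ⟩) - 1) μ ν x
          - curl (torusT P i) (fun κ z => unitsField (toUField U₀) ⟨z, κ⟩) (fun κ z => Complex.I • D ⟨z, κ⟩) μ ν x‖
        ≤ (Real.exp s - 1) * (‖covD (torusT P i) (fun κ z => unitsField (toUField U₀) ⟨z, κ⟩) μ (fun z => Complex.I • D ⟨z, ν⟩) x‖
              + ‖covD (torusT P i) (fun κ z => unitsField (toUField U₀) ⟨z, κ⟩) ν (fun z => Complex.I • D ⟨z, μ⟩) x‖) := by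
      rw [hdiff, mul_add]
      exact (norm_sub_le _ _).trans (add_le_add hA hB)
    have key := norm_le_insert'
      (curl (torusT P i) (fun κ z => unitsField (toUField U₀) ⟨z, κ⟩) (fun κ z => exp (Complex.I • D ⟨z, κ⟩) - 1) μ ν x)
      (curl (torusT P i) (fun κ z => unitsField (toUField U₀) ⟨z, κ⟩) (fun κ z => Complex.I • D ⟨z, κ⟩) μ ν x)
    have h1 := sum_norm_sq_le_mul_opNorm_sq
      (curl (torusT P i) (fun κ z => unitsField (toUField U₀) ⟨z, κ⟩) (fun κ z => exp (Complex.I • D ⟨z, κ⟩) - 1) μ ν x)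
    have h0 : 0 ≤ ‖curl (torusT P i) (fun κ z => unitsField (toUField U₀) ⟨z, κ⟩) (fun κ z => exp (Complex.I • D ⟨z, κ⟩) - 1) μ ν x‖ :=
      norm_nonneg _
    have hle := pow_le_pow_left₀ h0 (key.trans (add_le_add le_rfl hn)) 2
    have hab : ∀ (p q r : ℝ), (p + (q + r)) ^ 2 ≤ 2 * p ^ 2 + 4 * q ^ 2 + 4 * r ^ 2 := fun p q r => by
      nlinarith [sq_nonneg (p - q - r), sq_nonneg (q - r)]
    have h5 := hab ‖curl (torusT P i) (fun κ z => unitsField (toUField U₀) ⟨z, κ⟩) (fun κ z => Complex.I • D ⟨z, κ⟩) μ ν x‖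
      ((Real.exp s - 1) * ‖covD (torusT P i) (fun κ z => unitsField (toUField U₀) ⟨z, κ⟩) μ (fun z => Complex.I • D ⟨z, ν⟩) x‖)
      ((Real.exp s - 1) * ‖covD (torusT P i) (fun κ z => unitsField (toUField U₀) ⟨z, κ⟩) ν (fun z => Complex.I • D ⟨z, μ⟩) x‖)
    rw [mul_add] at hle
    nlinarith [mul_le_mul_of_nonneg_left (hle.trans h5) hN]
  -- under the `if`: keep the curl part inside, drop the `if` for the (non-negative) gradient part
  have hif : ∀ (x : Site P i) (μ ν : Fin P.d),
      (if μ < ν then ∑ j : Fin N, ∑ k : Fin N,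
          ‖(curl (torusT P i) (fun κ z => unitsField (toUField U₀) ⟨z, κ⟩) (fun κ z => exp (Complex.I • D ⟨z, κ⟩) - 1) μ ν x) j k‖ ^ 2 else 0)
        ≤ 2 * N * (if μ < ν then ∑ j : Fin N, ∑ k : Fin N,
              ‖(curl (torusT P i) (fun κ z => unitsField (toUField U₀) ⟨z, κ⟩) (fun κ z => Complex.I • D ⟨z, κ⟩) μ ν x) j k‖ ^ 2 else 0)
          + 4 * N * (Real.exp s - 1) ^ 2 *
            (‖covD (torusT P i) (fun κ z => unitsField (toUField U₀) ⟨z, κ⟩) μ (fun z => Complex.I • D ⟨z, ν⟩) x‖ ^ 2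
              + ‖covD (torusT P i) (fun κ z => unitsField (toUField U₀) ⟨z, κ⟩) ν (fun z => Complex.I • D ⟨z, μ⟩) x‖ ^ 2) := by
    intro x μ ν
    have hg : 0 ≤ 4 * N * (Real.exp s - 1) ^ 2 *
            (‖covD (torusT P i) (fun κ z => unitsField (toUField U₀) ⟨z, κ⟩) μ (fun z => Complex.I • D ⟨z, ν⟩) x‖ ^ 2
              + ‖covD (torusT P i) (fun κ z => unitsField (toUField U₀) ⟨z, κ⟩) ν (fun z => Complex.I • D ⟨z, μ⟩) x‖ ^ 2) := by positivity
    split_ifs with h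
    · have h2 := MatrixNorms.opNorm_sq_le_sum_norm_sq
        (curl (torusT P i) (fun κ z => unitsField (toUField U₀) ⟨z, κ⟩) (fun κ z => Complex.I • D ⟨z, κ⟩) μ ν x)
      nlinarith [hpt x μ ν, mul_le_mul_of_nonneg_left h2 (by positivity : (0 : ℝ) ≤ 2 * N)]
    · linarith
  have hsum := Finset.sum_le_sum fun x (_ : x ∈ (Finset.univ : Finset (Site P i))) =>
    Finset.sum_le_sum fun μ (_ : μ ∈ (Finset.univ : Finset (Fin P.d))) =>
      Finset.sum_le_sum fun ν (_ : ν ∈ (Finset.univ : Finset (Fin P.d))) => hif x μ ν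
  refine hsum.trans ?_
  simp only [Finset.sum_add_distrib, ← Finset.mul_sum]
  -- the two full gradient energies through Weitzenböck
  have hfull := sum_full_covD_sq_le_curl_divB U₀ ha hU (fun b => Complex.I • D b)
  have hgrad1 : ∑ x : Site P i, ∑ μ : Fin P.d, ∑ ν : Fin P.d,
        ‖covD (torusT P i) (fun κ z => unitsField (toUField U₀) ⟨z, κ⟩) μ (fun z => Complex.I • D ⟨z, ν⟩) x‖ ^ 2
      = ∑ x : Site P i, ∑ μ : Fin P.d, ∑ ν : Fin P.d,
        ‖covD (torusT P i) (fun κ z => unitsField (toUField U₀) ⟨z, κ⟩) ν (fun z => Complex.I • D ⟨z, μ⟩) x‖ ^ 2 :=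
    Finset.sum_congr rfl fun x _ => Finset.sum_comm
  rw [hgrad1]
  have hc : (0 : ℝ) ≤ 4 * N * (Real.exp s - 1) ^ 2 := by positivity
  nlinarith [mul_le_mul_of_nonneg_left hfull hc]

end Torus
end Summit.QuantumFields.YangMills.Theorems.Prop7PinnedRegaugeChartJunction

end
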